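import Summits.Ventures.GridStability.Models.SwingTubeTrig
import Summits.Ventures.GridStability.Models.ClassicalSwing
import Literature.Analysis.ODE.SecondOrderBoxEnclosure

/-!
# SwingTubeLegs — the GENERIC n-machine kernel tube integrator, part 2: rational swing data, interval field bounds, legs, ONE LEG

Venture GRIDFUSION (LADDER-GRIDFUSION G1-cct / G2 next-wave lever; seat gridfusion-model-1 g6).  Generalises the WSCC9 bus-7 integrator
(`WSCC9FaultOnTubeLegs`) from one hard-wired 3-machine fault to EVERY classical model with rational data: `SwingQ n` = `(M, D, P, E, G, B)`
over `ℚ` (e.g. a FAULT-ON network with the pre-fault mechanical inputs), `SwingQ.toModel : ClassicalSwing n` (casts).  §1 the natural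
interval extension of `P_{e,i}(δ) = E_i²G_ii + Σ_{j≠i} (C_ij sin(δ_i − δ_j) + D_ij cos(δ_i − δ_j))` over an angle box `[A, B]`
(`PeLo/PeHi`, every difference `δ_i − δ_j ∈ [A_i − B_j, B_i − A_j] ⊆ [−3, 3]`, termwise `SwingTube.term_mem`) — `Pe_mem`; §2 `KBox n`,
`Leg n` (duration `τ`, coordinate box `[A, B] × [C, D]`, claimed accelerations `[L, H]`), the Bool checks `Leg.fieldOK d` (`M_i > 0`,
differences in `[−3, 3]`, `L_i M_i ≤ P_i − PeHi_i − max(D_i C_i, D_i D_i)` and the mirror), `Leg.inclOK` (Moore's four strict inclusions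
at the full step), `Leg.next`, `chainOK`, `kboxAt`, `startAt`, `legAt`, the Set-valued `KBox.toSet` / `Leg.tubeSet`; §3 SOUNDNESS of the
field check (`fieldBounds_of_fieldOK`) and ONE LEG (`leg_step`: lit-1's `Literature.Analysis.ODE.secondOrder_tube_restart`, p501879,
re-based at the leg start, inclusions at the horizon `T − a ≤ τ` by isotonicity).  Chain theorem + slice boxes: `SwingTubeChain`.
THREE COLUMNS: CERTIFIED = tube sentences for a MODEL `d.toModel` (whatever classical model the data describe); no VALIDATED content; no
stability claim.  [cite: Moore1979, §8.1 eqs. (8.5), (8.10) and the step-by-step continuation after (8.5); §3.3]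
-/

noncomputable section

open Real Set Finset

namespace Summit.Ventures.GridStability.Models

namespace SwingTube

variable {n : ℕ}

/-! ### §1 Rational swing data and the interval extension of the electrical powers -/

/-- RATIONAL DATA of a classical swing model with `n` machines: inertias `M`, dampings `D`, mechanical inputs `P`, internal
voltages `E`, reduced conductances `G` and susceptances `B` (any network — pre-fault, FAULT-ON or post-fault). -/
structure SwingQ (n : ℕ) where
  /-- inertias `M_i` -/
  M : Fin n → ℚ
  /-- dampings `D_i` -/
  D : Fin n → ℚ
  /-- mechanical inputs `P_i` -/
  P : Fin n → ℚ
  /-- internal voltage magnitudes `E_i` -/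
  E : Fin n → ℚ
  /-- reduced conductances `G_ij` -/
  G : Fin n → Fin n → ℚ
  /-- reduced susceptances `B_ij` -/
  B : Fin n → Fin n → ℚ

namespace SwingQ

variable (d : SwingQ n)

/-- The classical model of the data (casts to `ℝ`). -/
def toModel : ClassicalSwing n where
  M i := (d.M i : ℝ)
  D i := (d.D i : ℝ)
  P i := (d.P i : ℝ)
  E i := (d.E i : ℝ)
  G i j := (d.G i j : ℝ)
  B i j := (d.B i j : ℝ)

/-- `C_ij = E_iE_jB_ij`, exact. -/
def Cc (i j : Fin n) : ℚ := d.E i * d.E j * d.B i j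

/-- `D_ij = E_iE_jG_ij`, exact. -/
def Dc (i j : Fin n) : ℚ := d.E i * d.E j * d.G i j

/-- The electrical power of the cast model in terms of the rational couplings. -/
theorem toModel_Pe (δ : Fin n → ℝ) (i : Fin n) :
    d.toModel.Pe δ i = ((d.E i ^ 2 * d.G i i : ℚ) : ℝ) +
      ∑ j ∈ Finset.univ.erase i, (((d.Cc i j : ℚ) : ℝ) * Real.sin (δ i - δ j) + ((d.Dc i j : ℚ) : ℝ) * Real.cos (δ i - δ j)) := by
  simp only [ClassicalSwing.Pe, ClassicalSwing.Ccoef, ClassicalSwing.Dcoef, toModel, Cc, Dc]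
  push_cast
  ring

/-- The speed equation of the cast model: `ω̇_i = (P_i − P_{e,i}(δ) − D_i ω_i)/M_i`. -/
theorem toModel_field_snd (x : ClassicalSwing.State n) (i : Fin n) :
    (d.toModel.field x).2 i = ((d.P i : ℝ) - d.toModel.Pe x.1 i - (d.D i : ℝ) * x.2 i) / (d.M i : ℝ) := rfl

/-- Electrical powers are invariant under a common shift of all angles (only differences enter). -/
theorem toModel_Pe_add_const (δ : Fin n → ℝ) (r : ℝ) (i : Fin n) :
    d.toModel.Pe (fun j => δ j + r) i = d.toModel.Pe δ i := by
  simp only [ClassicalSwing.Pe, add_sub_add_right_eq_sub]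

/-- Lower interval bound of `P_{e,i}` over the angle box `[A, B]` (natural interval extension, termwise). -/
def PeLo (A B : Fin n → ℚ) (i : Fin n) : ℚ :=
  d.E i ^ 2 * d.G i i + ∑ j ∈ Finset.univ.erase i, termLo (d.Cc i j) (d.Dc i j) (A i - B j) (B i - A j)

/-- Upper interval bound of `P_{e,i}` over the angle box `[A, B]`. -/
def PeHi (A B : Fin n → ℚ) (i : Fin n) : ℚ :=
  d.E i ^ 2 * d.G i i + ∑ j ∈ Finset.univ.erase i, termHi (d.Cc i j) (d.Dc i j) (A i - B j) (B i - A j)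

end SwingQ

/-- All angle differences of the box `[A, B]` lie in `[−3, 3]` (the range of the trig enclosures). -/
def diffOK (A B : Fin n → ℚ) : Bool :=
  decide (∀ i j : Fin n, i ≠ j → -3 ≤ A i - B j ∧ B i - A j ≤ 3)

/-- **Interval extension of the electrical powers.** `diffOK A B` and `δ ∈ [A, B]` ⇒ `PeLo ≤ P_{e,i}(δ) ≤ PeHi`. [folklore] -/
theorem Pe_mem (d : SwingQ n) {A B : Fin n → ℚ} (h : diffOK A B = true) {δ : Fin n → ℝ}
    (hδ : ∀ i, (A i : ℝ) ≤ δ i ∧ δ i ≤ (B i : ℝ)) (i : Fin n) :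
    ((d.PeLo A B i : ℚ) : ℝ) ≤ d.toModel.Pe δ i ∧ d.toModel.Pe δ i ≤ ((d.PeHi A B i : ℚ) : ℝ) := by
  simp only [diffOK, decide_eq_true_eq] at h
  rw [d.toModel_Pe]
  simp only [SwingQ.PeLo, SwingQ.PeHi]
  push_cast
  have key : ∀ j ∈ Finset.univ.erase i,
      ((termLo (d.Cc i j) (d.Dc i j) (A i - B j) (B i - A j) : ℚ) : ℝ) ≤
          ((d.Cc i j : ℚ) : ℝ) * Real.sin (δ i - δ j) + ((d.Dc i j : ℚ) : ℝ) * Real.cos (δ i - δ j) ∧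
        ((d.Cc i j : ℚ) : ℝ) * Real.sin (δ i - δ j) + ((d.Dc i j : ℚ) : ℝ) * Real.cos (δ i - δ j) ≤
          ((termHi (d.Cc i j) (d.Dc i j) (A i - B j) (B i - A j) : ℚ) : ℝ) := by
    intro j hj
    have hij : i ≠ j := (Finset.ne_of_mem_erase hj).symm
    obtain ⟨h1, h2⟩ := h i j hij
    exact term_mem h1 h2 (by push_cast; linarith [(hδ i).1, (hδ j).2]) (by push_cast; linarith [(hδ i).2, (hδ j).1])
  have lo := Finset.sum_le_sum fun j hj => (key j hj).1
  have hi := Finset.sum_le_sum fun j hj => (key j hj).2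
  exact ⟨by linarith, by linarith⟩

/-! ### §2 Boxes, legs and the rational checks -/

/-- A STATE BOX at a restart time: translated angles `q_i = δ_i − δ₀(0) ∈ [qlo_i, qhi_i]`, speeds `ω_i ∈ [wlo_i, whi_i]`. -/
structure KBox (n : ℕ) where
  /-- lower angle corners -/
  qlo : Fin n → ℚ
  /-- upper angle corners -/
  qhi : Fin n → ℚ
  /-- lower speed corners -/
  wlo : Fin n → ℚ
  /-- upper speed corners -/
  whi : Fin n → ℚ

/-- Two boxes with the same corners are equal (to spell computed boxes out as literals). -/
theorem KBox.eq_of_forall {K K' : KBox n}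
    (h : ∀ i, K.qlo i = K'.qlo i ∧ K.qhi i = K'.qhi i ∧ K.wlo i = K'.wlo i ∧ K.whi i = K'.whi i) : K = K' := by
  obtain ⟨a, b, c, e⟩ := K
  obtain ⟨a', b', c', e'⟩ := K'
  simp only [KBox.mk.injEq]
  exact ⟨funext fun i => (h i).1, funext fun i => (h i).2.1, funext fun i => (h i).2.2.1, funext fun i => (h i).2.2.2⟩

/-- ONE LEG: duration `τ`, coordinate box `[A, B]` (angles) `× [C, D]` (speeds) containing the leg's motion, claimed acceleration
bounds `[L, H]`. -/
structure Leg (n : ℕ) where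
  /-- leg duration -/
  τ : ℚ
  /-- angle box, lower corners -/
  A : Fin n → ℚ
  /-- angle box, upper corners -/
  B : Fin n → ℚ
  /-- speed box, lower corners -/
  C : Fin n → ℚ
  /-- speed box, upper corners -/
  D : Fin n → ℚ
  /-- claimed lower acceleration bounds -/
  L : Fin n → ℚ
  /-- claimed upper acceleration bounds -/
  H : Fin n → ℚ

namespace Leg

/-- FIELD CHECK against the data `d`: differences in `[−3, 3]`, `M_i > 0`, and the accelerations of `d.toModel` lie in `[L, H]` on
the box (interval powers `PeLo/PeHi`, sign-free damping term `D_i ω_i ∈ [min, max](D_i C_i, D_i D_i)`). -/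
def fieldOK (g : Leg n) (d : SwingQ n) : Bool :=
  diffOK g.A g.B && decide (∀ i : Fin n, 0 < d.M i) &&
  decide (∀ i : Fin n, g.L i * d.M i ≤ d.P i - d.PeHi g.A g.B i - max (d.D i * g.C i) (d.D i * g.D i) ∧
    d.P i - d.PeLo g.A g.B i - min (d.D i * g.C i) (d.D i * g.D i) ≤ g.H i * d.M i)

/-- INCLUSION CHECK (Moore's four strict inclusions at the full step `τ`, from the restart box `K`). -/
def inclOK (g : Leg n) (K : KBox n) : Bool :=
  decide (0 < g.τ) &&
  decide (∀ i : Fin n, g.A i < K.qlo i + min 0 (K.wlo i * g.τ) + min (g.L i) 0 * g.τ ^ 2 / 2 ∧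
    K.qhi i + max 0 (K.whi i * g.τ) + max (g.H i) 0 * g.τ ^ 2 / 2 < g.B i ∧
    g.C i < K.wlo i + min (g.L i) 0 * g.τ ∧ K.whi i + max (g.H i) 0 * g.τ < g.D i)

/-- The state box at the END of the leg. -/
def next (g : Leg n) (K : KBox n) : KBox n where
  qlo i := K.qlo i + K.wlo i * g.τ + g.L i * g.τ ^ 2 / 2
  qhi i := K.qhi i + K.whi i * g.τ + g.H i * g.τ ^ 2 / 2
  wlo i := K.wlo i + g.L i * g.τ
  whi i := K.whi i + g.H i * g.τ

/-- The TUBE SET of the leg re-based at the state `xa`, elapsed time `s`: machine-wise `L_i s ≤ ω_i − ωa_i ≤ H_i s` and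
`L_i s²/2 ≤ δ_i − δa_i − ωa_i s ≤ H_i s²/2`. -/
def tubeSet (g : Leg n) (xa : ClassicalSwing.State n) (s : ℝ) : Set (ClassicalSwing.State n) :=
  {x | ∀ i, (g.L i : ℝ) * s ≤ x.2 i - xa.2 i ∧ x.2 i - xa.2 i ≤ (g.H i : ℝ) * s ∧
    (g.L i : ℝ) * s ^ 2 / 2 ≤ x.1 i - xa.1 i - xa.2 i * s ∧ x.1 i - xa.1 i - xa.2 i * s ≤ (g.H i : ℝ) * s ^ 2 / 2}

/-- Unfolding `tubeSet` membership. -/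
theorem mem_tubeSet (g : Leg n) (xa x : ClassicalSwing.State n) (s : ℝ) :
    x ∈ g.tubeSet xa s ↔ ∀ i, (g.L i : ℝ) * s ≤ x.2 i - xa.2 i ∧ x.2 i - xa.2 i ≤ (g.H i : ℝ) * s ∧
      (g.L i : ℝ) * s ^ 2 / 2 ≤ x.1 i - xa.1 i - xa.2 i * s ∧ x.1 i - xa.1 i - xa.2 i * s ≤ (g.H i : ℝ) * s ^ 2 / 2 :=
  Iff.rfl

end Leg

/-- The STATE SET of the box `K` for the reference angle `r`: `x.δ_i − r ∈ [qlo_i, qhi_i]`, `x.ω_i ∈ [wlo_i, whi_i]`. -/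
def KBox.toSet (K : KBox n) (r : ℝ) : Set (ClassicalSwing.State n) :=
  {x | ∀ i, (K.qlo i : ℝ) ≤ x.1 i - r ∧ x.1 i - r ≤ (K.qhi i : ℝ) ∧ (K.wlo i : ℝ) ≤ x.2 i ∧ x.2 i ≤ (K.whi i : ℝ)}

/-- Unfolding `KBox.toSet` membership. -/
theorem KBox.mem_toSet (K : KBox n) (r : ℝ) (x : ClassicalSwing.State n) :
    x ∈ K.toSet r ↔ ∀ i, (K.qlo i : ℝ) ≤ x.1 i - r ∧ x.1 i - r ≤ (K.qhi i : ℝ) ∧ (K.wlo i : ℝ) ≤ x.2 i ∧ x.2 i ≤ (K.whi i : ℝ) :=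
  Iff.rfl

/-- CHAIN CHECK along a list of legs from the box `K`. -/
def chainOK (d : SwingQ n) : KBox n → List (Leg n) → Bool
  | _, [] => true
  | K, g :: gs => g.fieldOK d && g.inclOK K && chainOK d (g.next K) gs

/-- The state box at the start of leg `k`. -/
def kboxAt : KBox n → List (Leg n) → ℕ → KBox n
  | K, _, 0 => K
  | K, [], _ + 1 => K
  | K, g :: gs, k + 1 => kboxAt (g.next K) gs k

/-- The start time of leg `k`. -/
def startAt : ℚ → List (Leg n) → ℕ → ℚ
  | a, _, 0 => a
  | a, [], _ + 1 => a
  | a, g :: gs, k + 1 => startAt (a + g.τ) gs k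

/-- Leg `k` of the list (a dummy zero leg past the end). -/
def legAt (legs : List (Leg n)) (k : ℕ) : Leg n := legs.getD k ⟨0, 0, 0, 0, 0, 0, 0⟩

/-! ### §3 Soundness: the field check and one leg -/

/-- **Kernel field bounds from the rational check.** `g.fieldOK d` ⇒ on the box the accelerations of `d.toModel` lie in `[L, H]`. -/
theorem fieldBounds_of_fieldOK {g : Leg n} {d : SwingQ n} (h : g.fieldOK d = true) (x : ClassicalSwing.State n)
    (hx : ∀ i, (g.A i : ℝ) ≤ x.1 i ∧ x.1 i ≤ (g.B i : ℝ) ∧ (g.C i : ℝ) ≤ x.2 i ∧ x.2 i ≤ (g.D i : ℝ)) :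
    ∀ i, (g.L i : ℝ) ≤ (d.toModel.field x).2 i ∧ (d.toModel.field x).2 i ≤ (g.H i : ℝ) := by
  simp only [Leg.fieldOK, Bool.and_eq_true, decide_eq_true_eq] at h
  obtain ⟨⟨hdiff, hM⟩, hLH⟩ := h
  intro i
  have hMi : (0 : ℝ) < (d.M i : ℝ) := by exact_mod_cast hM i
  obtain ⟨hL, hH⟩ := hLH i
  have cL := (Rat.cast_le (K := ℝ)).2 hL
  have cH := (Rat.cast_le (K := ℝ)).2 hH
  push_cast at cL cH
  obtain ⟨p1, p2⟩ := Pe_mem d hdiff (fun j => ⟨(hx j).1, (hx j).2.1⟩) i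
  obtain ⟨w1, w2⟩ := mul_mem_minmax (d.D i : ℝ) (hx i).2.2.1 (hx i).2.2.2
  rw [d.toModel_field_snd]
  constructor
  · rw [le_div_iff₀ hMi]; linarith
  · rw [div_le_iff₀ hMi]; linarith

/-- **ONE LEG.** `g.fieldOK d`, `g.inclOK K`, `Y a ∈ K.toSet (δ₀(0))` with `a ≥ 0`, and a solution of `d.toModel` on `[0, T]` with
`a ≤ T ≤ a + τ` ⇒ the tube of `g` holds on `[a, T]` (lit-1's `secondOrder_tube_restart`). -/
theorem leg_step [NeZero n] {g : Leg n} {d : SwingQ n} {K : KBox n} (hf : g.fieldOK d = true) (hi : g.inclOK K = true)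
    {a T : ℝ} (ha : 0 ≤ a) (haT : a ≤ T) (hTτ : T - a ≤ (g.τ : ℝ)) {Y : ℝ → ClassicalSwing.State n}
    (hY : d.toModel.IsSolutionOn Y (Icc 0 T)) (hK : Y a ∈ K.toSet ((Y 0).1 0)) :
    ∀ t ∈ Icc a T, Y t ∈ g.tubeSet (Y a) (t - a) := by
  simp only [Leg.inclOK, Bool.and_eq_true, decide_eq_true_eq] at hi
  obtain ⟨hτ, hincl⟩ := hi
  rw [KBox.mem_toSet] at hK
  set r : ℝ := (Y 0).1 0 with hr
  set q : ℝ → Fin n → ℝ := fun s j => (Y s).1 j - r with hq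
  set v : ℝ → Fin n → ℝ := fun s j => (Y s).2 j with hv
  set G : ℝ → Fin n → ℝ := fun s j => (d.toModel.field (Y s)).2 j with hG
  have hqd : ∀ i, ∀ t ∈ Icc 0 T, HasDerivWithinAt (fun s => q s i) (v t i) (Icc 0 T) t := by
    intro i t ht
    have h1 : HasDerivWithinAt (fun s => (Y s).1) ((d.toModel.field (Y t)).1) (Icc 0 T) t :=
      (ContinuousLinearMap.fst ℝ (Fin n → ℝ) (Fin n → ℝ)).hasFDerivAt.comp_hasDerivWithinAt t (hY t ht)
    have h2 := (hasDerivWithinAt_pi.1 h1 i).sub_const r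
    simpa [hq, hv, ClassicalSwing.field] using h2
  have hvd : ∀ i, ∀ t ∈ Icc 0 T, HasDerivWithinAt (fun s => v s i) (G t i) (Icc 0 T) t := by
    intro i t ht
    have h1 : HasDerivWithinAt (fun s => (Y s).2) ((d.toModel.field (Y t)).2) (Icc 0 T) t :=
      (ContinuousLinearMap.snd ℝ (Fin n → ℝ) (Fin n → ℝ)).hasFDerivAt.comp_hasDerivWithinAt t (hY t ht)
    exact hasDerivWithinAt_pi.1 h1 i
  have hGB : ∀ t ∈ Icc a T, (∀ i, (g.A i : ℝ) ≤ q t i ∧ q t i ≤ (g.B i : ℝ) ∧ (g.C i : ℝ) ≤ v t i ∧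
      v t i ≤ (g.D i : ℝ)) → ∀ i, (g.L i : ℝ) ≤ G t i ∧ G t i ≤ (g.H i : ℝ) := by
    intro t _ hB i
    have hPe : ∀ j, d.toModel.Pe (fun k => (Y t).1 k - r) j = d.toModel.Pe (Y t).1 j := by
      intro j
      have := d.toModel_Pe_add_const (Y t).1 (-r) j
      simpa [sub_eq_add_neg] using this
    have hfield : (d.toModel.field ((fun k => (Y t).1 k - r), (Y t).2)).2 i = (d.toModel.field (Y t)).2 i := by
      simp only [ClassicalSwing.field, hPe]
    have key := fieldBounds_of_fieldOK hf ((fun k => (Y t).1 k - r), (Y t).2) hB i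
    rw [hfield] at key
    simpa [hG] using key
  have hs0 : 0 ≤ T - a := by linarith
  have hs2 : (T - a) ^ 2 ≤ (g.τ : ℝ) ^ 2 := pow_le_pow_left₀ hs0 hTτ 2
  have hKa : ∀ i, (g.A i : ℝ) < q a i + min 0 (v a i * (T - a)) + min (g.L i : ℝ) 0 * (T - a) ^ 2 / 2 := by
    intro i
    obtain ⟨k1, -, k3, -⟩ := hK i
    obtain ⟨c1, -, -, -⟩ := hincl i
    have c1' := (Rat.cast_lt (K := ℝ)).2 c1
    push_cast at c1'
    have m1 := WSCC9.FaultOnLeg.min_zero_mul_mono (τ := (g.τ : ℝ)) k3 hs0 hTτ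
    have m3 : min (g.L i : ℝ) 0 * (g.τ : ℝ) ^ 2 / 2 ≤ min (g.L i : ℝ) 0 * (T - a) ^ 2 / 2 := by
      have := mul_le_mul_of_nonpos_left hs2 (min_le_right (g.L i : ℝ) 0)
      linarith
    have e1 : q a i = (Y a).1 i - (Y 0).1 0 := rfl
    rw [e1]
    linarith
  have hKb : ∀ i, q a i + max 0 (v a i * (T - a)) + max (g.H i : ℝ) 0 * (T - a) ^ 2 / 2 < (g.B i : ℝ) := by
    intro i
    obtain ⟨-, k2, -, k4⟩ := hK i
    obtain ⟨-, c2, -, -⟩ := hincl i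
    have c2' := (Rat.cast_lt (K := ℝ)).2 c2
    push_cast at c2'
    have m2 := WSCC9.FaultOnLeg.max_zero_mul_mono (τ := (g.τ : ℝ)) k4 hs0 hTτ
    have m4 : max (g.H i : ℝ) 0 * (T - a) ^ 2 / 2 ≤ max (g.H i : ℝ) 0 * (g.τ : ℝ) ^ 2 / 2 := by
      have := mul_le_mul_of_nonneg_left hs2 (le_max_right (g.H i : ℝ) 0)
      linarith
    have e1 : q a i = (Y a).1 i - (Y 0).1 0 := rfl
    rw [e1]
    linarith
  have hKc : ∀ i, (g.C i : ℝ) < v a i + min (g.L i : ℝ) 0 * (T - a) := by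
    intro i
    obtain ⟨-, -, k3, -⟩ := hK i
    obtain ⟨-, -, c3, -⟩ := hincl i
    have c3' := (Rat.cast_lt (K := ℝ)).2 c3
    push_cast at c3'
    have m5 : min (g.L i : ℝ) 0 * (g.τ : ℝ) ≤ min (g.L i : ℝ) 0 * (T - a) :=
      mul_le_mul_of_nonpos_left hTτ (min_le_right (g.L i : ℝ) 0)
    have e1 : v a i = (Y a).2 i := rfl
    rw [e1]
    linarith
  have hKd : ∀ i, v a i + max (g.H i : ℝ) 0 * (T - a) < (g.D i : ℝ) := by
    intro i
    obtain ⟨-, -, -, k4⟩ := hK i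
    obtain ⟨-, -, -, c4⟩ := hincl i
    have c4' := (Rat.cast_lt (K := ℝ)).2 c4
    push_cast at c4'
    have m6 : max (g.H i : ℝ) 0 * (T - a) ≤ max (g.H i : ℝ) 0 * (g.τ : ℝ) :=
      mul_le_mul_of_nonneg_left hTτ (le_max_right (g.H i : ℝ) 0)
    have e1 : v a i = (Y a).2 i := rfl
    rw [e1]
    linarith
  have key := Literature.Analysis.ODE.secondOrder_tube_restart (a := a) ha haT
    (lo₂ := fun i => (g.L i : ℝ)) (hi₂ := fun i => (g.H i : ℝ))
    (a₂ := fun i => (g.A i : ℝ)) (b₂ := fun i => (g.B i : ℝ)) (c₂ := fun i => (g.C i : ℝ))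
    (d₂ := fun i => (g.D i : ℝ)) hqd hvd hGB hKa hKb hKc hKd
  intro t ht
  rw [Leg.mem_tubeSet]
  intro i
  obtain ⟨k1, k2, k3, k4⟩ := key t ht i
  have e1 : v t i - v a i = (Y t).2 i - (Y a).2 i := rfl
  have e2 : q t i - q a i - v a i * (t - a) = (Y t).1 i - (Y a).1 i - (Y a).2 i * (t - a) := by
    simp only [hq, hv]; ring
  rw [e1] at k1 k2
  rw [e2] at k3 k4
  exact ⟨k1, k2, k3, k4⟩

end SwingTube

end Summit.Ventures.GridStability.Models

end
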